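import Summits.SmoothPoincare4.SmoothPoincare4.Theorems.CongruenceShadowsAbelianShadowStandard
import HarnessLib

/-!
# Stub `stub_abelianLevels` of line `prym-layer-stable-rank` for crux
`CongruenceShadows.ShadowsStandard` (item stmt-SmoothPoincare4-14593, route
route-SmoothPoincare4-CongruenceShadows)

**The abelian stratum.** Let `S = SurfaceGroup (3 + 3m)`, `N = s4Kernels.stabilizeIter m` the
standard `(3+3m; m+1)` trisection of `S⁴`, and `K` any `(3+3m; m+1)` group trisection of the
trivial group. For every characteristic level `M` of `S` with abelian quotient, i.e.
`⁅S, S⁆ ≤ M`, ONE automorphism `ψ` of `S` carries the standard level-`M` shadow `(Nᵢ ⊔ M)ᵢ`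
onto `(Kᵢ ⊔ M)ᵢ`, `i = 0, 1, 2`.

Proof. The tree theorem `AbelianShadowStandard.abelianShadowStandard_proof` (item 14599) is the
level `γ₂ S = (⊤ : Subgroup S).lowerCentralSeries 1`, which is `⁅⊤, ⊤⁆` definitionally
(`Subgroup.lowerCentralSeries_succ`, `Subgroup.lowerCentralSeries_zero`). Monotonicity in the
level then finishes: from `(Nᵢ ⊔ γ₂).map ψ = Kᵢ ⊔ γ₂`, `γ₂ ≤ M` and `M` characteristic,
`Nᵢ ⊔ M = (Nᵢ ⊔ γ₂) ⊔ M`, `Kᵢ ⊔ M = (Kᵢ ⊔ γ₂) ⊔ M`, push `Subgroup.map_sup` and use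
`M.map ψ = M` (`Subgroup.characteristic_iff_map_eq`).

The file declares theorems only.
-/

-- the prescribed namespace `Summit.<P>.<Sub>.…` duplicates `SmoothPoincare4` (P = Sub)
set_option linter.dupNamespace false

noncomputable section

namespace Summit.SmoothPoincare4.SmoothPoincare4.Theorems.ShadowsStandard.PrymLayerStableRank

open Literature.Topology.FourManifolds
open Subgroup

/-! ## Monotonicity of level-wise standardness -/

/-- **Monotonicity in the level.** If an automorphism `ψ` of a group `G` carries `Aᵢ ⊔ M'` onto
`Bᵢ ⊔ M'` for every index `i`, then it carries `Aᵢ ⊔ M` onto `Bᵢ ⊔ M` for every characteristic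
`M ⊇ M'` (no hypothesis on `M'`): `Aᵢ ⊔ M = (Aᵢ ⊔ M') ⊔ M`, push `map_sup`, `M.map ψ = M`.
[folklore] -/
theorem map_sup_eq_of_le_characteristic {G : Type*} [Group G] {ι : Sort*}
    (A B : ι → Subgroup G) {M' M : Subgroup G} (hle : M' ≤ M) (hM : M.Characteristic)
    (ψ : G ≃* G) (hψ : ∀ i, (A i ⊔ M').map ψ.toMonoidHom = B i ⊔ M') (i : ι) :
    (A i ⊔ M).map ψ.toMonoidHom = B i ⊔ M := by
  have e1 : A i ⊔ M = (A i ⊔ M') ⊔ M := by rw [sup_assoc, sup_eq_right.2 hle]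
  have e2 : B i ⊔ M = (B i ⊔ M') ⊔ M := by rw [sup_assoc, sup_eq_right.2 hle]
  rw [e1, e2, Subgroup.map_sup, hψ i, (characteristic_iff_map_eq.1 hM) ψ]

/-! ## The stub -/

/-- **Stub `stub_abelianLevels` (the abelian stratum of `ShadowsStandard`).** For every
`(3+3m; m+1)` group trisection `K` of the trivial group and every characteristic subgroup `M` of
the surface group `S = SurfaceGroup (3 + 3m)` containing `⁅S, S⁆`, some automorphism `ψ` of `S`
satisfies `ψ (Nᵢ ⊔ M) = Kᵢ ⊔ M` for `i = 0, 1, 2`, `N = s4Kernels.stabilizeIter m`. Immediate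
from `abelianShadowStandard_proof` (the level `γ₂ S = ⁅S, S⁆`) and monotonicity
`map_sup_eq_of_le_characteristic`. [folklore] -/
theorem stub_abelianLevels :
    ∀ (m : ℕ) (K : TrisectionKernels (3 + 3 * m)),
      IsGroupTrisection (3 + 3 * m) (m + 1) (PUnit : Type) K →
      ∀ M : Subgroup (SurfaceGroup (3 + 3 * m)), M.Characteristic →
      ⁅(⊤ : Subgroup (SurfaceGroup (3 + 3 * m))), (⊤ : Subgroup (SurfaceGroup (3 + 3 * m)))⁆ ≤ M →
      ∃ ψ : SurfaceGroup (3 + 3 * m) ≃* SurfaceGroup (3 + 3 * m), ∀ i : Fin 3,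
        (s4Kernels.stabilizeIter m i ⊔ M).map ψ.toMonoidHom = K i ⊔ M := by
  intro m K hK M hM hle
  obtain ⟨ψ, hψ⟩ :=
    Summit.SmoothPoincare4.SmoothPoincare4.Theorems.AbelianShadowStandard.abelianShadowStandard_proof
      m K hK
  -- `(⊤).lowerCentralSeries 1 = ⁅(⊤).lowerCentralSeries 0, ⊤⁆ = ⁅⊤, ⊤⁆`, definitionally
  have hγ : (⊤ : Subgroup (SurfaceGroup (3 + 3 * m))).lowerCentralSeries 1 =
      ⁅(⊤ : Subgroup (SurfaceGroup (3 + 3 * m))), (⊤ : Subgroup (SurfaceGroup (3 + 3 * m)))⁆ := by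
    rw [Subgroup.lowerCentralSeries_succ, Subgroup.lowerCentralSeries_zero]
  rw [hγ] at hψ
  exact ⟨ψ, map_sup_eq_of_le_characteristic (s4Kernels.stabilizeIter m) K hle hM ψ hψ⟩

end Summit.SmoothPoincare4.SmoothPoincare4.Theorems.ShadowsStandard.PrymLayerStableRank

end
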